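import Literature.Probability.RandomPlanarGeometry.LoewnerDrivingBound
import Literature.Probability.RandomPlanarGeometry.LoewnerSimpleIncrement
import Literature.Analysis.Complex.LengthAreaDiameter
import HarnessLib

/-!
# The modulus of continuity of the driving function from the modulus of the curve (simple phase)

Topic `Literature/Probability/RandomPlanarGeometry` (family `crit-ising`); theorems only (no
definition, no named fact). The DETERMINISTIC converse of Lawler's Lemma 4.13
(`Loewner.hull_subset_closedBall_driving`: the driving function controls the hull): for a chordal
Loewner chain generated by a SIMPLE curve `γ` with continuous driving function `W`, a small
increment `γ[s, t]` of the curve forces a small increment `W_t - W_s` of the driving function,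
quantitatively and uniformly —

  `|W_t - W_s| ≤ 581 · 8π (1 + 580 R) / √(log (1/d))`

whenever `γ[0, s] ⊆ B̄(0, R)` and `γ(s, t] ⊆ B(γ(s), d)`, `0 < d < 1`
(`Loewner.IsGeneratedByCurve.abs_driving_sub_driving_le_of_ball`). Proof (Lawler (2005), §3.4
and §4.1; the length–area argument in the form of the tree's `LengthAreaDiameter.lean`): the
recentred increment chain `V = W(s + ·) - W(s)` is generated by the simple curve
`β = g_s(γ(s + ·)) - W(s)` (`Loewner.IsGeneratedByCurve.incr_sub`, the deterministic domain Markov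
property); by Wolff's length–area lemma applied to the conformal map `g_s : ℍ ∖ γ(0, s] → ℍ`,
which moves points by at most `580 R` (Lawler (3.12), `IsHydrodynamicMap.norm_sub_self_le`), the
image `g_s(γ(s, t])` of the small preconnected set `γ(s, t] ⊆ B(γ(s), d)` has diameter
`≤ 8π (1 + 580 R)/√(log (1/d))` (`LengthArea.norm_sub_le_of_isPreconnected`), and it accumulates
at `W(s) = β(0)`; so `β[0, t - s]` lies in the disc of that radius about `0`, whence the bound on
`|V(t - s)| = |W_t - W_s|` by `Loewner.IsGeneratedByCurve.abs_driving_le` (KS eq. (10) /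
Lawler (3.12) once more).

* `Loewner.IsGeneratedByCurve.norm_map_sub_map_le_of_ball` — the Wolff step;
* `Loewner.IsGeneratedByCurve.norm_incrCurve_sub_driving_le_of_ball` — the increment curve stays
  within that radius of `W(s)`;
* `Loewner.IsGeneratedByCurve.abs_driving_sub_driving_le_of_ball` — the increment bound;
* `Loewner.IsGeneratedByCurve.abs_driving_sub_driving_le_of_modulus` — **a modulus of the
  curve on `[0, T]` (in capacity parametrisation) is a modulus of the driving function**:
  if `γ[0, T] ⊆ B̄(0, R)` and `dist r r' ≤ η ⟹ ‖γ r - γ r'‖ < d` on `[0, T]`, then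
  `dist s t ≤ η ⟹ |W_t - W_s| ≤ 581 · 8π (1 + 580 R)/√(log (1/d))` on `[0, T]`.

Use. For LATTICE interfaces read through a uniformizing map, one lattice step is a set of small
diameter, so this is the deterministic modulus of the discrete driving process below the mesh
scale (the "floor" of `Process/ModulusFromIncrementTails.lean`, Kemppainen–Smirnov 2017 §4.1.6:
Condition G2, hence the probabilistic increment control, is only available above the mesh);
and in general it turns the curve event `E₂` of KS §3.5 read in capacity time into the
driving event `E₃`.

## References

* G. F. Lawler, *Conformally Invariant Processes in the Plane*, AMS (2005), §3.4 (3.12), §3.7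
  (3.21) (length–area), §4.1 Lemma 4.13, §6.2 (increment chains). [Lawler2005]
* A. Kemppainen, S. Smirnov, Ann. Probab. 45 (2017) 698–779, §3.3 eq. (10), §4.1.6.
  [KemppainenSmirnov2017]
* Ch. Pommerenke, *Boundary Behaviour of Conformal Maps* (1992), Prop. 2.2. [PommerenkeBBCM1992]
-/

noncomputable section

open Set Filter Topology Metric Complex Function Real
open UpperHalfPlane (upperHalfPlaneSet isOpen_upperHalfPlaneSet)
open scoped NNReal

namespace Literature.Probability.RandomPlanarGeometry

namespace Loewner

variable {W : ℝ≥0 → ℝ} {γ : ℝ≥0 → ℂ}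

/-- **Wolff's lemma for the Loewner map of a simple curve.** If `γ[0, s] ⊆ B̄(0, R)` then for
`0 < d < 1` and any two later curve points `γ r₁, γ r₂` (`s < rᵢ ≤ t`) all of whose
intermediate piece `γ(s, t]` lies in `B(γ(s), d)`, the images under `g_s` satisfy
`‖g_s(γ r₁) - g_s(γ r₂)‖ ≤ 8π (1 + 580 R)/√(log (1/d))`: `g_s` is a conformal bijection
`ℍ ∖ γ(0, s] → ℍ` moving points by at most `580 R` (Lawler (3.12)), and `γ(s, t]` is a
preconnected subset of `ℍ ∖ γ(0, s]` of size `d` (length–area,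
`LengthArea.norm_sub_le_of_isPreconnected`). [cite: Lawler2005, §3.4 (3.12) and §3.7 (3.21)] -/
theorem IsGeneratedByCurve.norm_map_sub_map_le_of_ball (hγ : IsGeneratedByCurve W γ)
    (hs : IsSimpleTrace γ) (hW : Continuous W) {s t : ℝ≥0} {R d : ℝ} (hR0 : 0 < R)
    (hR : γ '' Icc 0 s ⊆ closedBall (0 : ℂ) R) (hd0 : 0 < d) (hd1 : d < 1)
    (hd : ∀ r, s < r → r ≤ t → dist (γ r) (γ s) < d) {r₁ r₂ : ℝ≥0}
    (h₁ : s < r₁) (h₁t : r₁ ≤ t) (h₂ : s < r₂) (h₂t : r₂ ≤ t) :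
    ‖map W s (γ r₁) - map W s (γ r₂)‖ ≤ 8 * π * (1 + 580 * R) / √(Real.log (1 / d)) := by
  -- the displacement bound of `g_s`
  have hC : ∀ z ∈ domain W s, ‖map W s z - z‖ ≤ 580 * R := by
    intro z hz
    obtain ⟨φ, hφ⟩ := exists_conformalEquiv_map_holds hW s
    have hH := isHydrodynamicMap_of_eqOn hW s hφ
    have h1 := hH.norm_sub_self_le (hγ.hull_inter_subset_closedBall hR) hR0 hz
    rwa [hφ hz] at h1
  -- the small preconnected set `Q = γ(s, t]`
  set Q : Set ℂ := γ '' Ioc s t with hQ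
  have hQc : IsPreconnected Q := isPreconnected_Ioc.image γ hγ.continuous.continuousOn
  have hQU : Q ⊆ domain W s := by
    rintro _ ⟨r, hr, rfl⟩
    exact hγ.apply_mem_domain_of_lt hs hr.1
  have hQd : Q ⊆ ball (γ s) d := by
    rintro _ ⟨r, hr, rfl⟩
    exact hd r hr.1 hr.2
  exact Literature.Analysis.Complex.LengthArea.norm_sub_le_of_isPreconnected (isOpen_domain hW s)
    (differentiableOn_map hW s) (mapsTo_map hW s) (f := loewnerInv W s)
    (fun z hz ↦ loewnerInv_mem_domain hW s hz)
    (differentiableOn_invFunOn_map hW s).continuousOn (fun w hw ↦ map_loewnerInv hW s hw)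
    (fun z hz ↦ loewnerInv_map hW hz) hC hd0 hd1 hQc hQU hQd ⟨r₁, ⟨h₁, h₁t⟩, rfl⟩
    ⟨r₂, ⟨h₂, h₂t⟩, rfl⟩

/-- **The increment curve stays near `W(s)`.** Under the hypotheses of
`norm_map_sub_map_le_of_ball`, for `0 < r ≤ t - s` the point `β(r) = g_s(γ(s + r))` of the
increment curve is within `8π (1 + 580 R)/√(log (1/d))` of `β(0) = W(s)` (let the second point
tend to `s⁺` along the curve: `β` is continuous at `0`, `Loewner.continuous_incrCurve`).
[cite: Lawler2005, §6.2 and §3.7 (3.21)] -/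
theorem IsGeneratedByCurve.norm_incrCurve_sub_driving_le_of_ball (hγ : IsGeneratedByCurve W γ)
    (hs : IsSimpleTrace γ) (hW : Continuous W) {s u : ℝ≥0} {R d : ℝ} (hR0 : 0 < R)
    (hR : γ '' Icc 0 s ⊆ closedBall (0 : ℂ) R) (hd0 : 0 < d) (hd1 : d < 1)
    (hd : ∀ r, s < r → r ≤ s + u → dist (γ r) (γ s) < d) {r : ℝ≥0} (hr : 0 < r) (hru : r ≤ u) :
    ‖incrCurve W γ s r - W s‖ ≤ 8 * π * (1 + 580 * R) / √(Real.log (1 / d)) := by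
  -- `β r' → β 0 = W s` as `r' → 0⁺`
  have hlim : Tendsto (fun r' : ℝ≥0 ↦ ‖incrCurve W γ s r - incrCurve W γ s r'‖) (𝓝[>] 0)
      (𝓝 ‖incrCurve W γ s r - W s‖) := by
    have h0 := ((continuous_incrCurve hγ hs hW s).tendsto 0).mono_left
      (nhdsWithin_le_nhds (s := Ioi (0 : ℝ≥0)))
    rw [incrCurve_zero] at h0
    exact (tendsto_const_nhds.sub h0).norm
  refine le_of_tendsto hlim ?_
  filter_upwards [Ioc_mem_nhdsGT hr] with r' hr'
  rw [incrCurve_of_pos W γ s hr, incrCurve_of_pos W γ s hr'.1]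
  exact hγ.norm_map_sub_map_le_of_ball hs hW hR0 hR hd0 hd1 hd (lt_add_of_pos_right s hr)
    (add_le_add le_rfl hru) (lt_add_of_pos_right s hr'.1) (add_le_add le_rfl (hr'.2.trans hru))

/-- **A small increment of a simple generating curve forces a small increment of the driving
function.** Let the chordal Loewner chain of the continuous `W` be generated by the simple curve
`γ`, let `γ[0, s] ⊆ B̄(0, R)` and `‖γ r - γ s‖ < d` for `s < r ≤ s + u`, with `0 < d < 1`. Then
`|W(s + u) - W(s)| ≤ 581 · 8π (1 + 580 R)/√(log (1/d))`: the recentred increment chain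
`W(s + ·) - W(s)` is generated by `β - W(s)` (`IsGeneratedByCurve.incr_sub`), whose trace on
`[0, u]` lies in the disc of radius `8π (1 + 580 R)/√(log (1/d))` about `0`
(`norm_incrCurve_sub_driving_le_of_ball`), and the driving function of a chain generated by a
curve in `B̄(0, ρ)` is bounded by `581 ρ` (`IsGeneratedByCurve.abs_driving_le`).
[cite: Lawler2005, §4.1 Lemma 4.13, §3.4 (3.12), §3.7 (3.21)] -/
theorem IsGeneratedByCurve.abs_driving_sub_driving_le_of_ball (hγ : IsGeneratedByCurve W γ)
    (hs : IsSimpleTrace γ) (hW : Continuous W) {s u : ℝ≥0} {R d : ℝ} (hR0 : 0 < R)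
    (hR : γ '' Icc 0 s ⊆ closedBall (0 : ℂ) R) (hd0 : 0 < d) (hd1 : d < 1)
    (hd : ∀ r, s < r → r ≤ s + u → dist (γ r) (γ s) < d) :
    |W (s + u) - W s| ≤ 581 * (8 * π * (1 + 580 * R) / √(Real.log (1 / d))) := by
  set ρ : ℝ := 8 * π * (1 + 580 * R) / √(Real.log (1 / d)) with hρ
  have hlog : 0 < Real.log (1 / d) := Real.log_pos (by rw [lt_div_iff₀ hd0]; linarith)
  have hρ0 : 0 < ρ := by positivity
  -- the recentred increment curve stays in `B̄(0, ρ)` on `[0, u]`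
  have hsub : (fun v ↦ incrCurve W γ s v - W s) '' Icc 0 u ⊆ closedBall (0 : ℂ) ρ := by
    rintro _ ⟨v, hv, rfl⟩
    rw [mem_closedBall, dist_zero_right]
    rcases (show (0 : ℝ≥0) ≤ v from bot_le).eq_or_lt with h0 | h0
    · subst h0
      simp only [incrCurve_zero, sub_self, norm_zero]
      exact hρ0.le
    · exact hγ.norm_incrCurve_sub_driving_le_of_ball hs hW hR0 hR hd0 hd1 hd h0 hv.2
  have hV : Continuous fun v : ℝ≥0 ↦ W (s + v) - W s :=
    (hW.comp (continuous_const.add continuous_id)).sub continuous_const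
  exact (hγ.incr_sub hs hW s).abs_driving_le hV hρ0 hsub

/-- **A modulus of continuity of the curve (in capacity parametrisation) is a modulus of
continuity of the driving function.** Let the chain of the continuous `W` be generated by the
simple curve `γ` with `γ[0, T] ⊆ B̄(0, R)`, and suppose `‖γ r - γ r'‖ < d` whenever
`r, r' ≤ T`, `dist r r' ≤ η` (`0 < d < 1`). Then `|W t - W s| ≤ 581 · 8π (1 + 580 R)/√(log (1/d))`
whenever `s, t ≤ T`, `dist s t ≤ η`. (For `d ↓ 0` the right-hand side tends to `0`: the driving
function inherits a modulus from the curve, with an explicit `1/√(log (1/d))` loss.)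
[cite: Lawler2005, §4.1 Lemma 4.13 and §3.7 (3.21)] -/
theorem IsGeneratedByCurve.abs_driving_sub_driving_le_of_modulus (hγ : IsGeneratedByCurve W γ)
    (hs : IsSimpleTrace γ) (hW : Continuous W) {T : ℝ≥0} {R d η : ℝ} (hR0 : 0 < R)
    (hR : γ '' Icc 0 T ⊆ closedBall (0 : ℂ) R) (hd0 : 0 < d) (hd1 : d < 1)
    (hmod : ∀ r r' : ℝ≥0, r ≤ T → r' ≤ T → dist r r' ≤ η → dist (γ r) (γ r') < d)
    {s t : ℝ≥0} (hsT : s ≤ T) (htT : t ≤ T) (hst : dist s t ≤ η) :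
    |W t - W s| ≤ 581 * (8 * π * (1 + 580 * R) / √(Real.log (1 / d))) := by
  -- reduce to `s ≤ t`
  wlog hle : s ≤ t generalizing s t
  · rw [abs_sub_comm]
    rw [dist_comm] at hst
    exact this htT hsT hst (le_of_not_ge hle)
  obtain ⟨u, rfl⟩ : ∃ u, t = s + u := ⟨t - s, (add_tsub_cancel_of_le hle).symm⟩
  have hRs : γ '' Icc 0 s ⊆ closedBall (0 : ℂ) R :=
    (image_mono (Icc_subset_Icc_right hsT)).trans hR
  refine hγ.abs_driving_sub_driving_le_of_ball hs hW hR0 hRs hd0 hd1 fun r hsr hru ↦ ?_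
  refine hmod r s (hru.trans htT) hsT (le_trans ?_ hst)
  -- `dist r s ≤ dist s (s + u)`
  have hrs : (s : ℝ) ≤ r := by exact_mod_cast hsr.le
  have hru' : (r : ℝ) ≤ s + u := by exact_mod_cast hru
  rw [NNReal.dist_eq, NNReal.dist_eq, NNReal.coe_add, abs_of_nonneg (by linarith),
    abs_of_nonpos (by linarith [u.coe_nonneg])]
  linarith

end Loewner

end Literature.Probability.RandomPlanarGeometry
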